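import Summits.RiemannHypothesis.RiemannHypothesis.Theorems.GroundBartaPolarPerronFrobeniusSourceCriterion
import Summits.RiemannHypothesis.RiemannHypothesis.Theorems.WeilGroundStateMarkovPartPositiveGroundStatePhase
import HarnessLib

/-!
# RiemannHypothesis / GroundBarta — crux `PolarPerronFrobenius` (stmt-RiemannHypothesis-18390):
# the source criterion IN THE FORM DOMAIN, part G1: `L²` fold identities

Helper file (`--supports stmt-RiemannHypothesis-18390`), RH-free, Mathlib + proved tree files only,
no definitions, no named facts.

Parts S1–S4 proved the source criterion for smooth TESTS.  To apply it to a GROUND STATE `u` itself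
(an `L²` function of finite energy, not a test) the increment and polar identities are redone here for a
REAL `u ∈ L²(ℝ)` vanishing a.e. off the window (`p = u⁺`, `n = u⁻`, `U = u`, `A = |u|` as complex
functions):

* `swg_weilIncrement_sub_abs`: `D_t(U) − D_t(A) = 4∫ n(x)(p(x+t) + p(x−t)) dx` for every `t`;
* `swg_weilPoleForm_abs_sub_eq`: `P(A) − P(U) = 8∫ n(y) (∫ p(x)cosh((x−y)/2) dx) dy`;
* the `L²` bookkeeping (`swg_memLp_posPart`, `swg_integrable_posPart`, …).

Part G2 does the Tonelli step for the (untruncated) archimedean gain and proves the ground-state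
source criterion: a real ground state whose source is positive on its negative set is `≥ 0` a.e.

Prover B, speedrun unit `sr-gb-rung-b` (seat 2).
-/

set_option linter.dupNamespace false

noncomputable section

open Set MeasureTheory Filter Complex
open scoped Real Topology

namespace Summit.RiemannHypothesis.RiemannHypothesis.Theorems.PolarPerronFrobenius

open Literature.NumberTheory.LFunctions

section L2

variable {u : ℝ → ℝ} {a : ℝ}

/-- `u⁺ ∈ L²` for `u ∈ L²` (real). [folklore] -/
theorem swg_memLp_posPart (hu : MemLp u 2 volume) : MemLp (fun x ↦ max (u x) 0) 2 volume :=
  MemLp.of_le hu (hu.1.aemeasurable.max aemeasurable_const).aestronglyMeasurable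
    (Eventually.of_forall fun x ↦ by
      simp only [Real.norm_eq_abs]
      rcases le_total 0 (u x) with h | h
      · rw [max_eq_left h, abs_of_nonneg h]
      · rw [max_eq_right h, abs_zero]; exact abs_nonneg _)

/-- `u⁻ ∈ L²` for `u ∈ L²` (real). [folklore] -/
theorem swg_memLp_negPart (hu : MemLp u 2 volume) : MemLp (fun x ↦ max (-u x) 0) 2 volume :=
  swg_memLp_posPart (u := fun x ↦ -u x) hu.neg

/-- An `L²` function vanishing a.e. off `[-a, a]` is integrable. [folklore] -/
theorem swg_integrable_of_memLp (hu : MemLp u 2 volume) (hus : ∀ᵐ x : ℝ, x ∉ Icc (-a) a → u x = 0) :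
    Integrable u := by
  have h : IntegrableOn u (Icc (-a) a) := (hu.restrict (Icc (-a) a)).integrable one_le_two
  exact h.integrable_of_ae_notMem_eq_zero hus

/-- `u⁺` vanishes a.e. off the window if `u` does. [folklore] -/
theorem swg_posPart_ae_zero (hus : ∀ᵐ x : ℝ, x ∉ Icc (-a) a → u x = 0) :
    ∀ᵐ x : ℝ, x ∉ Icc (-a) a → max (u x) 0 = 0 := by
  filter_upwards [hus] with x hx hxm
  rw [hx hxm, max_self]

/-- `u⁻` vanishes a.e. off the window if `u` does. [folklore] -/
theorem swg_negPart_ae_zero (hus : ∀ᵐ x : ℝ, x ∉ Icc (-a) a → u x = 0) :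
    ∀ᵐ x : ℝ, x ∉ Icc (-a) a → max (-u x) 0 = 0 := by
  filter_upwards [hus] with x hx hxm
  rw [hx hxm, neg_zero, max_self]

/-- A weighted piece `x ↦ v(x) φ(x)` of an integrable `v` vanishing a.e. off `[-a,a]`, `φ` continuous,
is integrable. [folklore] -/
theorem swg_integrable_mul_continuous {v : ℝ → ℝ} (hv : Integrable v)
    (hvs : ∀ᵐ x : ℝ, x ∉ Icc (-a) a → v x = 0) {φ : ℝ → ℝ} (hφ : Continuous φ) :
    Integrable fun x ↦ v x * φ x := by
  have h : IntegrableOn (fun x ↦ v x * φ x) (Icc (-a) a) :=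
    hv.integrableOn.mul_continuousOn hφ.continuousOn isCompact_Icc
  exact h.integrable_of_ae_notMem_eq_zero (by
    filter_upwards [hvs] with x hx hxm
    rw [hx hxm, zero_mul])

/-- The complexification of a real `L²` function is in `L²`. [folklore] -/
theorem swg_memLp_ofReal (hu : MemLp u 2 volume) : MemLp (fun x ↦ ((u x : ℝ) : ℂ)) 2 volume :=
  MemLp.of_le hu (Complex.continuous_ofReal.comp_aestronglyMeasurable hu.1)
    (Eventually.of_forall fun x ↦ by simp)

end L2

/-! ## The increment fold identity in `L²` -/

section Increment

variable {u : ℝ → ℝ} {a : ℝ}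

/-- **`D_t(u) − D_t(|u|) = 4∫ u⁻(x)(u⁺(x+t) + u⁺(x−t)) dx`** for a real `u ∈ L²(ℝ)`. [folklore] -/
theorem swg_weilIncrement_sub_abs (hu : MemLp u 2 volume) (t : ℝ) :
    weilIncrement (fun x ↦ ((u x : ℝ) : ℂ)) t - weilIncrement (fun x ↦ ((|u x| : ℝ) : ℂ)) t =
      4 * ∫ x, max (-u x) 0 * (max (u (x + t)) 0 + max (u (x - t)) 0) := by
  have hp := swg_memLp_posPart hu
  have hn := swg_memLp_negPart hu
  have hFm := swg_memLp_ofReal hu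
  have hAm : MemLp (fun x ↦ ((|u x| : ℝ) : ℂ)) 2 volume := by
    have h := swg_memLp_ofReal (u := fun x ↦ |u x|) hu.abs
    exact h
  have iF := integrable_weilIncrement_integrand hFm t
  have iA := integrable_weilIncrement_integrand hAm t
  have hpt : ∀ x, ‖((u (x + t) : ℝ) : ℂ) - ((u x : ℝ) : ℂ)‖ ^ 2 -
      ‖((|u (x + t)| : ℝ) : ℂ) - ((|u x| : ℝ) : ℂ)‖ ^ 2 =
        4 * (max (-u x) 0 * max (u (x + t)) 0) + 4 * (max (-u (x + t)) 0 * max (u x) 0) := by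
    intro x
    rw [← Complex.ofReal_sub, ← Complex.ofReal_sub, Complex.norm_real, Complex.norm_real,
      Real.norm_eq_abs, Real.norm_eq_abs, sq_abs, sq_abs, swe_sq_sub_sq_abs]
    ring
  -- integrability of the pieces (products of `L²` functions)
  have hpt' : MemLp (fun x ↦ max (u (x + t)) 0) 2 volume :=
    hp.comp_measurePreserving (measurePreserving_add_right volume t)
  have hnt' : MemLp (fun x ↦ max (-u (x + t)) 0) 2 volume :=
    hn.comp_measurePreserving (measurePreserving_add_right volume t)
  have hpt'' : MemLp (fun x ↦ max (u (x - t)) 0) 2 volume :=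
    hp.comp_measurePreserving (measurePreserving_sub_right volume t)
  have i1' : Integrable fun x ↦ max (-u x) 0 * max (u (x + t)) 0 := hn.integrable_mul hpt'
  have i2 : Integrable fun x ↦ max (-u x) 0 * max (u (x - t)) 0 := hn.integrable_mul hpt''
  have i3' : Integrable fun x ↦ max (-u (x + t)) 0 * max (u x) 0 := hnt'.integrable_mul hp
  have i1 : Integrable fun x ↦ 4 * (max (-u x) 0 * max (u (x + t)) 0) := i1'.const_mul 4
  have i3 : Integrable fun x ↦ 4 * (max (-u (x + t)) 0 * max (u x) 0) := i3'.const_mul 4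
  have htr : ∫ x, 4 * (max (-u (x + t)) 0 * max (u x) 0) = ∫ x, 4 * (max (-u x) 0 * max (u (x - t)) 0) := by
    have h := integral_add_right_eq_self (μ := volume)
      (fun x ↦ 4 * (max (-u x) 0 * max (u (x - t)) 0)) t
    simp only [add_sub_cancel_right] at h
    exact h
  unfold weilIncrement
  rw [← integral_sub iF iA]
  simp_rw [hpt]
  rw [integral_add i1 i3, htr, integral_const_mul, integral_const_mul, ← mul_add,
    ← integral_add i1' i2]
  congr 1
  refine integral_congr_ae (Eventually.of_forall fun x ↦ ?_)
  simp only
  ring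

end Increment

/-! ## The polar fold identity in `L²` -/

section Polar

variable {u : ℝ → ℝ} {a : ℝ}

/-- `∫ |u| φ = ∫ u⁺ φ + ∫ u⁻ φ` and `∫ u φ = ∫ u⁺ φ − ∫ u⁻ φ` (complex pairings of real casts), for
`u ∈ L²` vanishing a.e. off the window and `φ` continuous. [folklore] -/
theorem swg_integral_abs_self_mul_eq (hu : MemLp u 2 volume)
    (hus : ∀ᵐ x : ℝ, x ∉ Icc (-a) a → u x = 0) {φ : ℝ → ℝ} (hφ : Continuous φ) :
    (∫ t, ((|u t| : ℝ) : ℂ) * ((φ t : ℝ) : ℂ) =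
        (((∫ t, max (u t) 0 * φ t) + ∫ t, max (-u t) 0 * φ t : ℝ) : ℂ)) ∧
      (∫ t, ((u t : ℝ) : ℂ) * ((φ t : ℝ) : ℂ) =
        (((∫ t, max (u t) 0 * φ t) - ∫ t, max (-u t) 0 * φ t : ℝ) : ℂ)) := by
  have hpi : Integrable fun x ↦ max (u x) 0 :=
    swg_integrable_of_memLp (swg_memLp_posPart hu) (swg_posPart_ae_zero hus)
  have hni : Integrable fun x ↦ max (-u x) 0 :=
    swg_integrable_of_memLp (swg_memLp_negPart hu) (swg_negPart_ae_zero hus)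
  have h1 := swg_integrable_mul_continuous hpi (swg_posPart_ae_zero hus) hφ
  have h2 := swg_integrable_mul_continuous hni (swg_negPart_ae_zero hus) hφ
  constructor
  · rw [← integral_add h1 h2, ← integral_complex_ofReal]
    congr 1 with t
    have habs : |u t| = max (u t) 0 + max (-u t) 0 := by
      rcases le_total 0 (u t) with h | h
      · rw [abs_of_nonneg h, max_eq_left h, max_eq_right (by linarith), add_zero]
      · rw [abs_of_nonpos h, max_eq_right h, max_eq_left (by linarith), zero_add]
    rw [habs]; push_cast; ring
  · rw [← integral_sub h1 h2, ← integral_complex_ofReal]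
    congr 1 with t
    have := sw_self_eq_posPart_sub_negPart (u t)
    push_cast
    rw [← sub_mul, ← Complex.ofReal_sub, ← this]

/-- **Polar fold identity in `L²`**: `P(|u|) − P(u) = 8∫ u⁻(y) (∫ u⁺(x) cosh((x−y)/2) dx) dy`
for a real `u ∈ L²` vanishing a.e. off `[-a, a]`. [folklore] -/
theorem swg_weilPoleForm_abs_sub_eq (hu : MemLp u 2 volume)
    (hus : ∀ᵐ x : ℝ, x ∉ Icc (-a) a → u x = 0) :
    weilPoleForm (fun t ↦ ((|u t| : ℝ) : ℂ)) - weilPoleForm (fun t ↦ ((u t : ℝ) : ℂ)) =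
      8 * ∫ y, max (-u y) 0 * ∫ x, max (u x) 0 * Real.cosh ((x - y) / 2) := by
  have hcosh : Continuous fun t : ℝ ↦ Real.cosh (t / 2) :=
    Real.continuous_cosh.comp (continuous_id.div_const 2)
  have hsinh : Continuous fun t : ℝ ↦ Real.sinh (t / 2) :=
    Real.continuous_sinh.comp (continuous_id.div_const 2)
  set Cp : ℝ := ∫ t, max (u t) 0 * Real.cosh (t / 2) with hCp
  set Cm : ℝ := ∫ t, max (-u t) 0 * Real.cosh (t / 2) with hCm
  set Sp : ℝ := ∫ t, max (u t) 0 * Real.sinh (t / 2) with hSp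
  set Sm : ℝ := ∫ t, max (-u t) 0 * Real.sinh (t / 2) with hSm
  obtain ⟨e1, e3⟩ := swg_integral_abs_self_mul_eq hu hus hcosh
  obtain ⟨e2, e4⟩ := swg_integral_abs_self_mul_eq hu hus hsinh
  have hP : weilPoleForm (fun t ↦ ((|u t| : ℝ) : ℂ)) - weilPoleForm (fun t ↦ ((u t : ℝ) : ℂ)) =
      8 * (Cp * Cm - Sp * Sm) := by
    unfold weilPoleForm
    rw [e1, e2, e3, e4]
    simp only [Complex.norm_real, Real.norm_eq_abs, sq_abs]
    ring
  have hpi : Integrable fun x ↦ max (u x) 0 :=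
    swg_integrable_of_memLp (swg_memLp_posPart hu) (swg_posPart_ae_zero hus)
  have hni : Integrable fun x ↦ max (-u x) 0 :=
    swg_integrable_of_memLp (swg_memLp_negPart hu) (swg_negPart_ae_zero hus)
  have ipc := swg_integrable_mul_continuous hpi (swg_posPart_ae_zero hus) hcosh
  have ips := swg_integrable_mul_continuous hpi (swg_posPart_ae_zero hus) hsinh
  have key : ∀ y, ∫ x, max (u x) 0 * Real.cosh ((x - y) / 2) =
      Real.cosh (y / 2) * Cp - Real.sinh (y / 2) * Sp := by
    intro y
    have hpt : ∀ x, max (u x) 0 * Real.cosh ((x - y) / 2) =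
        Real.cosh (y / 2) * (max (u x) 0 * Real.cosh (x / 2)) -
          Real.sinh (y / 2) * (max (u x) 0 * Real.sinh (x / 2)) := by
      intro x; rw [show (x - y) / 2 = x / 2 - y / 2 by ring, Real.cosh_sub]; ring
    simp_rw [hpt]
    rw [integral_sub (ipc.const_mul _) (ips.const_mul _), integral_const_mul, integral_const_mul]
  simp_rw [key]
  have inc := swg_integrable_mul_continuous hni (swg_negPart_ae_zero hus) hcosh
  have ins := swg_integrable_mul_continuous hni (swg_negPart_ae_zero hus) hsinh
  have hsplit : ∫ y, max (-u y) 0 * (Real.cosh (y / 2) * Cp - Real.sinh (y / 2) * Sp) = Cp * Cm - Sp * Sm := by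
    have hpt : ∀ y, max (-u y) 0 * (Real.cosh (y / 2) * Cp - Real.sinh (y / 2) * Sp) =
        Cp * (max (-u y) 0 * Real.cosh (y / 2)) - Sp * (max (-u y) 0 * Real.sinh (y / 2)) := by
      intro y; ring
    simp_rw [hpt]
    rw [integral_sub (inc.const_mul _) (ins.const_mul _), integral_const_mul, integral_const_mul]
  rw [hP, hsplit]

end Polar

end Summit.RiemannHypothesis.RiemannHypothesis.Theorems.PolarPerronFrobenius

end
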